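/-
Copyright (c) 2026. All rights reserved.
Released under Apache 2.0 license as described in the file LICENSE.
-/
import Summits.CriticalPhenomena.LaceExpansionHighD.NobleBoundsNMidECutRMid
import HarnessLib

/-!
# Fitzner–van der Hofstad (2017), Prop. 5.5 (5.34) at `N = M + 2` against the SHARP blocks, hypothesis-free — Part
II §D–§E: the corner cut-through (`R`) cell packages of the FIRST junction and of a MIDDLE junction over a CLOSED
lower level (bodies = `NobleBoundsNFirstECut` / `NobleBoundsNLowE` verbatim except for the split third `A`-line)
(WHAT-IF, DIVERGENCE D77; b2b-lace LEMMAS node N76-X2-D77, module 6/11)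

[FvdH17] = R. Fitzner, R. van der Hofstad, *Mean-field behavior for nearest-neighbor percolation in `d > 10`*,
arXiv:1506.07977v2 (EJP 22 (2017), paper 43).  Page numbers refer to the arXiv version.

SPLIT PROVENANCE: module 6 of 11 of the b2b-lace node N76-X2-D77 (what-if, DIVERGENCE D77) — the 11 modules are the
section-seam split (carver-g217, 2026-08-27) of the single-module form `NobleBoundsNSharpD77.lean` (carver-g51
text-final, sha256 `877e12977f9f9c92`, 2707 lines): every declaration, statement and proof is carried over verbatim and
in the original order; only module boundaries, the repeated `section`/`variable` headers and two docstrings were added.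
PLACEMENT: what-if objects of `NobleBlocksSharp` (b2b-lace LEAN PLACEMENT RULE, REFEREE R491), hence
`namespace Summit.CriticalPhenomena.LaceExpansionHighD.NobleBlocks`.  Conventions: `d`-generic; every declaration
carries its [FvdH17] display / page cite in the docstring; NOTHING is cited as a fact (b2b-lace ABSOLUTE RULE);
additive (no existing declaration is changed). -/

noncomputable section

namespace Summit.CriticalPhenomena.LaceExpansionHighD.NobleBlocks

open Literature.Probability.FitznerVanDerHofstad2017 Literature.Probability.FitznerVanDerHofstad2017.NobleBlocks
open Literature.Probability.FitznerVanDerHofstad2017.NobleBlocks.LenIdx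
open Literature.Probability.LatticeModels Literature.Probability.Percolation
open Literature.Probability.FitznerVanDerHofstad2017.BlockSummation
open Literature.Barriers.CriticalPhenomena
open Literature.Combinatorics.SimpleGraph _root_.SimpleGraph _root_.MeasureTheory
open scoped BigOperators ENNReal Matrix

variable {d : ℕ}

/-! ### D. FIRST junction: the corner cut-through packages behind the start letter -/

section First

variable (p : unitInterval) (M : ℕ) (x : Site d) (b : Fin (M + 2) → Site d × Site d) (w t z : Fin (M + 2) → Site d)
  (a : Fin (M + 2) → Fin 3 ⊕ Unit) (c : Fin 3 ⊕ Unit) (τ : Fin (M + 1) → Bool × Fin 3)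

/-- **The cut-through cells `(a_0, ·, a_1)` of the FIRST junction, variant `F″` (`t_0 ≠ u_1`), regime `z_0 = t_0`, ON
the corner `w_1 ~ t_0`**: a package with target
`P^{S,a_0}(u_0,w_0) · ((A^{κ,a_0,a_1} + A^{κ,a_0,1})(u_0,w_0,w_1,t_0) · P^{S,0}(u_1 − t_0, u_1 − t_0))`; for `a_1 ≤ 1`
the piece is empty.
[cite: FitznerVanDerHofstad2017, §5.1 (5.1)–(5.4) (arXiv:1506.07977v2 pp. 46–48); §6.1 (6.4), "Case a = 0 / 1 / ≥ 2", "b = 1", "b ≥ 2" (pp. 58–59); App. B (pp. 73, 75); §4.4 (4.57), (4.58), (4.64) (pp. 41–42)] -/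
theorem nonempty_jPkg_firstE_cutR (κ : Fin d × Bool)
    (hb : (b (0 : Fin (M + 1)).castSucc).2 = (b (0 : Fin (M + 1)).castSucc).1 + stepVec κ) (hσ : (τ 0).1 = true)
    (a₀ : Fin 3) (ha : a (0 : Fin (M + 1)).castSucc = Sum.inl a₀) {a' : Fin 3}
    (ha' : a (0 : Fin (M + 1)).succ = Sum.inl a') (hty : t (0 : Fin (M + 1)).castSucc ≠ (b (0 : Fin (M + 1)).succ).1)
    (hzt : z (0 : Fin (M + 1)).castSucc = t (0 : Fin (M + 1)).castSucc)
    (hadj : (zdGraph d).Adj (w (0 : Fin (M + 1)).succ) (t (0 : Fin (M + 1)).castSucc)) :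
    Nonempty (JPkg p (jctx M x b w t z a τ (0 : Fin (M + 1)).castSucc) (JFacts M x b w t z a c τ)
      (blockPS (Letters.perc d p) a₀ (b (0 : Fin (M + 1)).castSucc).1 (w (0 : Fin (M + 1)).castSucc) *
        ((blockAiota (Letters.perc d p) κ a₀ a' (b (0 : Fin (M + 1)).castSucc).1 (w (0 : Fin (M + 1)).castSucc)
              (w (0 : Fin (M + 1)).succ) (t (0 : Fin (M + 1)).castSucc) +
            blockAiota (Letters.perc d p) κ a₀ 1 (b (0 : Fin (M + 1)).castSucc).1 (w (0 : Fin (M + 1)).castSucc)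
              (w (0 : Fin (M + 1)).succ) (t (0 : Fin (M + 1)).castSucc)) *
          blockPS (Letters.perc d p) 0 ((b (0 : Fin (M + 1)).succ).1 - t (0 : Fin (M + 1)).castSucc)
            ((b (0 : Fin (M + 1)).succ).1 - t (0 : Fin (M + 1)).castSucc)))) := by
  -- exit class `a′ ≤ 1` above: the piece is empty (clause (8))
  by_cases h2 : a' = 2
  swap
  · exact nonempty_jPkg_of_sharp p c _ 0 hσ ha' h2 hty _
  subst h2
  -- degenerate parameters: the piece is empty
  by_cases hP : (b (0 : Fin (M + 1)).castSucc).1 ≠ t (0 : Fin (M + 1)).castSucc ∧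
      (b (0 : Fin (M + 1)).castSucc).1 ≠ w (0 : Fin (M + 1)).succ ∧
      (b (0 : Fin (M + 1)).castSucc).1 ≠ z (0 : Fin (M + 1)).castSucc ∧
      (b (0 : Fin (M + 1)).castSucc).2 ≠ z (0 : Fin (M + 1)).castSucc ∧
      w (0 : Fin (M + 1)).succ ≠ t (0 : Fin (M + 1)).castSucc ∧
      ((b (0 : Fin (M + 1)).castSucc).1 = 0 → w (0 : Fin (M + 1)).castSucc = 0) ∧
      (a₀ = 0 → w (0 : Fin (M + 1)).castSucc = (b (0 : Fin (M + 1)).castSucc).1) ∧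
      (a₀ = 1 → (zdGraph d).Adj (b (0 : Fin (M + 1)).castSucc).1 (w (0 : Fin (M + 1)).castSucc)) ∧
      (a₀ = 2 → (b (0 : Fin (M + 1)).castSucc).1 ≠ w (0 : Fin (M + 1)).castSucc)
  swap
  · refine ⟨JPkg.vacuous p _ _ (fun ω K₀ hF => hP ?_) _⟩
    obtain ⟨-, -, hwt, hut, huw', huz, hvz, hcan, hw0, hw1, hw2⟩ := firstECut_facts M x b w t z a c τ hF hσ ha ha' hty
    exact ⟨hut, huw', huz, hvz, hwt, hcan, hw0, hw1, hw2⟩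
  obtain ⟨hut, huw', huz, hvz, hwt, hcan, hw0, hw1, hw2⟩ := hP
  obtain ⟨X0, X1, X2, f0, f1, f2, hmem₀, hrow₀⟩ :=
    first_startLetter_gl p M x b w t z a c τ glFirstS3 true false (.lo 0) rfl rfl rfl ha hcan hw0 hw1 hw2
  -- the memberships shared by all rows
  have hm0 : ∀ ω K₀, JFacts M x b w t z a c τ ω K₀ →
      K₀ (0 : Fin (M + 1)).castSucc.succ 0 ∈
          (event (ge 0) (b (0 : Fin (M + 1)).castSucc).2 (w (0 : Fin (M + 1)).succ) : Set (BondConfig (Site d))) ∧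
        K₀ (0 : Fin (M + 1)).castSucc.succ 1 ∈
          (event (ge 1) (w (0 : Fin (M + 1)).succ) (t (0 : Fin (M + 1)).castSucc) : Set (BondConfig (Site d))) ∧
        K₀ (0 : Fin (M + 1)).castSucc.succ 3 ∈
          (event (ge 0) (t (0 : Fin (M + 1)).castSucc) (b (0 : Fin (M + 1)).succ).1 : Set (BondConfig (Site d))) ∧
        K₀ (0 : Fin (M + 1)).castSucc.succ 4 ∈
          (event (ge 0) (t (0 : Fin (M + 1)).castSucc) (b (0 : Fin (M + 1)).succ).1 : Set (BondConfig (Site d))) := by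
    intro ω K₀ hF
    obtain ⟨h0, h1, -, h3, h4⟩ := hF.conn_midE 0 hσ ha'
    rw [hzt] at h4
    refine ⟨?_, ?_, ?_, ?_⟩
    · rw [event_ge]; exact mem_openConnGe_zero_of_mem h0
    · rw [event_ge]; exact mem_openConnGe_one_of_ne h1 hwt
    · rw [event_ge]; exact mem_openConnGe_zero_of_mem h3
    · rw [event_ge]; exact mem_openConnGe_zero_of_mem h4
  -- the `P^{S,0}` letter (two routes of the last sausage), shared by all rows
  have hrow₂ : ∀ X3 E0 E1 : Set (BondConfig (Site d)),
      junF p M x b w t z a τ (0 : Fin (M + 1)).castSucc glFirstS3 true false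
        (firstEvS (event (eq 1) (b (0 : Fin (M + 1)).castSucc).1 (b (0 : Fin (M + 1)).castSucc).2) X0 X1 X2 X3 E0 E1
          Set.univ (event (ge 0) (t (0 : Fin (M + 1)).castSucc) (b (0 : Fin (M + 1)).succ).1)
          (event (ge 0) (t (0 : Fin (M + 1)).castSucc) (b (0 : Fin (M + 1)).succ).1)) (.up 2) ≤
      blockPS (Letters.perc d p) 0 ((b (0 : Fin (M + 1)).succ).1 - t (0 : Fin (M + 1)).castSucc)
        ((b (0 : Fin (M + 1)).succ).1 - t (0 : Fin (M + 1)).castSucc) := by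
    intro X3 E0 E1
    refine (junF_firstECut_up_le₂ p M x b w t z a τ hσ ha' _ _ _ _ _ _ _ _ _ _).trans ?_
    rw [← blockPE_zero]
    exact piPerc_end_zero_le_blockPE p rfl _ rfl
  by_cases h0 : a₀ = 0
  · subst h0
    have hwu : w (0 : Fin (M + 1)).castSucc = (b (0 : Fin (M + 1)).castSucc).1 := hw0 rfl
    have huv : (zdGraph d).Adj (b (0 : Fin (M + 1)).castSucc).1 (b (0 : Fin (M + 1)).castSucc).2 :=
      (zdGraph_adj_iff_stepVec _ _).2 ⟨κ, hb⟩
    by_cases hx : w (0 : Fin (M + 1)).succ = (b (0 : Fin (M + 1)).castSucc).2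
    · -- row `a = 0`, sub-row `x = e`: the exit line `u_0 → t_0` has length `≥ 2` by parity
      have hna : ¬ (zdGraph d).Adj (b (0 : Fin (M + 1)).castSucc).1 (t (0 : Fin (M + 1)).castSucc) :=
        not_adj_of_adj_adj huv (by rw [← hx]; exact hadj)
      refine nonempty_jPkg_firstECut_core p M x b w t z a c τ κ hb hσ ha' X0 X1 X2
        (event (ge 2) (t (0 : Fin (M + 1)).castSucc) (b (0 : Fin (M + 1)).castSucc).1)
        (event (ge 0) (b (0 : Fin (M + 1)).castSucc).2 (w (0 : Fin (M + 1)).succ))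
        (event (ge 1) (w (0 : Fin (M + 1)).succ) (t (0 : Fin (M + 1)).castSucc))
        (event (ge 0) (t (0 : Fin (M + 1)).castSucc) (b (0 : Fin (M + 1)).succ).1)
        (event (ge 0) (t (0 : Fin (M + 1)).castSucc) (b (0 : Fin (M + 1)).succ).1) f0 f1 f2 (isFinitary_event _ _ _)
        (isFinitary_event _ _ _) (isFinitary_event _ _ _) (isFinitary_event _ _ _) (isFinitary_event _ _ _)
        (fun ω K₀ hF => ?_) (hrow₀ _ rfl rfl rfl) ?_ (hrow₂ _ _ _)
      · obtain ⟨m0, m1, m3, m4⟩ := hm0 ω K₀ hF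
        refine ⟨(hmem₀ ω K₀ hF).1, (hmem₀ ω K₀ hF).2.1, (hmem₀ ω K₀ hF).2.2, ?_, m0, m1, m3, m4⟩
        obtain ⟨-, -, h3⟩ := hF.conn_first
        rw [hzt, hwu] at h3
        rw [event_comm, event_ge]
        refine mem_openConnGe_two_of_notMem h3 hut fun hm => hna ?_
        exact (SimpleGraph.mem_edgeSet _).1 (hF.lattice _ (hF.witness_subset _ 3 hm))
      · refine (junF_firstECut_xb_le₄ p M x b w t z a τ hσ ha' _ _ _ _ _ _ _ _ _ _).trans ?_
        rw [hwu, hx]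
        exact piPerc_cutR_zero_e_le p hb (fun h => hut h.symm) huv.ne.symm (fun h => hwt (hx.trans h)) _
    · -- row `a = 0`, sub-row `x ≠ e`: the square
      refine nonempty_jPkg_firstECut_core p M x b w t z a c τ κ hb hσ ha' X0 X1 X2
        (endX 0 (b (0 : Fin (M + 1)).castSucc).1 (w (0 : Fin (M + 1)).castSucc) (z (0 : Fin (M + 1)).castSucc))
        (event (ge 1) (b (0 : Fin (M + 1)).castSucc).2 (w (0 : Fin (M + 1)).succ))
        (event (ge 1) (w (0 : Fin (M + 1)).succ) (t (0 : Fin (M + 1)).castSucc))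
        (event (ge 0) (t (0 : Fin (M + 1)).castSucc) (b (0 : Fin (M + 1)).succ).1)
        (event (ge 0) (t (0 : Fin (M + 1)).castSucc) (b (0 : Fin (M + 1)).succ).1) f0 f1 f2 (isFinitary_endX _ _ _ _)
        (isFinitary_event _ _ _) (isFinitary_event _ _ _) (isFinitary_event _ _ _) (isFinitary_event _ _ _)
        (fun ω K₀ hF => ?_) (hrow₀ _ rfl rfl rfl) ?_ (hrow₂ _ _ _)
      · obtain ⟨-, m1, m3, m4⟩ := hm0 ω K₀ hF
        obtain ⟨h0', -⟩ := hF.conn_midE 0 hσ ha'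
        refine ⟨(hmem₀ ω K₀ hF).1, (hmem₀ ω K₀ hF).2.1, (hmem₀ ω K₀ hF).2.2,
          firstSOpen_exit_mem M x b w t z a c τ hF huz hw0, ?_, m1, m3, m4⟩
        rw [event_ge]; exact mem_openConnGe_one_of_ne h0' fun h => hx h.symm
      · refine (junF_firstECut_xb_le₄ p M x b w t z a τ hσ ha' _ _ _ _ _ _ _ _ _ _).trans ?_
        rw [hzt, endX, if_pos rfl, hwu]
        exact piPerc_cutR_zero_ne_le p hb (fun h => hut h.symm) (fun h => huw' h.symm) hwt _
  · -- rows `a = 1`, `a ≥ 2`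
    refine nonempty_jPkg_firstECut_core p M x b w t z a c τ κ hb hσ ha' X0 X1 X2
      (endX a₀ (b (0 : Fin (M + 1)).castSucc).1 (w (0 : Fin (M + 1)).castSucc) (z (0 : Fin (M + 1)).castSucc))
      (event (ge 0) (b (0 : Fin (M + 1)).castSucc).2 (w (0 : Fin (M + 1)).succ))
      (event (ge 1) (w (0 : Fin (M + 1)).succ) (t (0 : Fin (M + 1)).castSucc))
      (event (ge 0) (t (0 : Fin (M + 1)).castSucc) (b (0 : Fin (M + 1)).succ).1)
      (event (ge 0) (t (0 : Fin (M + 1)).castSucc) (b (0 : Fin (M + 1)).succ).1) f0 f1 f2 (isFinitary_endX _ _ _ _)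
      (isFinitary_event _ _ _) (isFinitary_event _ _ _) (isFinitary_event _ _ _) (isFinitary_event _ _ _)
      (fun ω K₀ hF => ?_) (hrow₀ _ rfl rfl rfl) ?_ (hrow₂ _ _ _)
    · obtain ⟨m0, m1, m3, m4⟩ := hm0 ω K₀ hF
      exact ⟨(hmem₀ ω K₀ hF).1, (hmem₀ ω K₀ hF).2.1, (hmem₀ ω K₀ hF).2.2,
        firstSOpen_exit_mem M x b w t z a c τ hF huz hw0, m0, m1, m3, m4⟩
    · refine (junF_firstECut_xb_le₄ p M x b w t z a τ hσ ha' _ _ _ _ _ _ _ _ _ _).trans ?_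
      rw [hzt, endX, if_neg h0]
      obtain h1 | h2 : a₀ = 1 ∨ a₀ = 2 := by
        fin_cases a₀
        · exact absurd rfl h0
        · exact Or.inl rfl
        · exact Or.inr rfl
      · subst h1
        obtain ⟨κ', hκ'⟩ := (zdGraph_adj_iff_stepVec _ _).1 (hw1 rfl)
        exact piPerc_cutR_one_le p hb hκ' hwt _
      · subst h2
        exact piPerc_cutR_two_le p hb hwt _

/-- **The first-junction corner cut-through cells in the shape of the Sharp cell `(true, 0)` behind the start
letter**: `P^{S,a_0}(u_0,w_0) · (tgtRegB … (true,0) + blockXR …)` — the slot `hR₀` of the Sharp dispatch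
(b2b-lace LEMMAS node N76-X2-D77, leaf T2b) at the first pair.
[cite: FitznerVanDerHofstad2017, §5.1 (5.1)–(5.4) (arXiv:1506.07977v2 pp. 46–48); §6.1 (6.4) (pp. 58–59); App. B (pp. 73, 75); §4.4 (4.64) (p. 42)] -/
theorem nonempty_jPkg_firstE_cutR_sharp (κ : Fin d × Bool)
    (hb : (b (0 : Fin (M + 1)).castSucc).2 = (b (0 : Fin (M + 1)).castSucc).1 + stepVec κ) (hσ : (τ 0).1 = true)
    (a₀ : Fin 3) (ha : a (0 : Fin (M + 1)).castSucc = Sum.inl a₀) {a' : Fin 3}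
    (ha' : a (0 : Fin (M + 1)).succ = Sum.inl a') (h2 : a' = 2)
    (hty : t (0 : Fin (M + 1)).castSucc ≠ (b (0 : Fin (M + 1)).succ).1)
    (hzt : z (0 : Fin (M + 1)).castSucc = t (0 : Fin (M + 1)).castSucc)
    (hadj : (zdGraph d).Adj (w (0 : Fin (M + 1)).succ) (t (0 : Fin (M + 1)).castSucc)) :
    Nonempty (JPkg p (jctx M x b w t z a τ (0 : Fin (M + 1)).castSucc) (JFacts M x b w t z a c τ)
      (blockPS (Letters.perc d p) a₀ (b (0 : Fin (M + 1)).castSucc).1 (w (0 : Fin (M + 1)).castSucc) *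
        (tgtRegB (Letters.perc d p) κ a₀ a' (b (0 : Fin (M + 1)).castSucc).1 (w (0 : Fin (M + 1)).castSucc)
            (t (0 : Fin (M + 1)).castSucc) (z (0 : Fin (M + 1)).castSucc) (w (0 : Fin (M + 1)).succ)
            (b (0 : Fin (M + 1)).succ).1 (true, 0) +
          blockXR (Letters.perc d p) κ a₀ a' (b (0 : Fin (M + 1)).castSucc).1 (w (0 : Fin (M + 1)).castSucc)
            (t (0 : Fin (M + 1)).castSucc) (z (0 : Fin (M + 1)).castSucc) (w (0 : Fin (M + 1)).succ)
            (b (0 : Fin (M + 1)).succ).1))) := by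
  subst h2
  obtain ⟨P⟩ := nonempty_jPkg_firstE_cutR p M x b w t z a c τ κ hb hσ a₀ ha ha' hty hzt hadj
  refine ⟨P.monoTgt (mul_le_mul' le_rfl (le_of_eq ?_))⟩
  have e2 : blockAiota' (Letters.perc d p) κ a₀ 2 = blockAiota (Letters.perc d p) κ a₀ 2 :=
    blockAiota'_of_ne _ _ fun h => absurd h.2 (by decide)
  have e1 : blockAiota' (Letters.perc d p) κ a₀ 1 = blockAiota (Letters.perc d p) κ a₀ 1 :=
    blockAiota'_of_ne _ _ fun h => absurd h.2 (by decide)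
  simp only [blockXR, tgtRegB_true_zero, blockT2Sharp_two, hzt, kd_self, kdc_of_ne hty, one_mul, e2, e1, add_mul]

end First

/-! ### E. MIDDLE junction over a CLOSED lower level: the corner cut-through packages of the lower-`★` pair -/

section Low

variable (p : unitInterval) (M : ℕ) (x : Site d) (b : Fin (M + 2) → Site d × Site d) (w t z : Fin (M + 2) → Site d)
  (a : Fin (M + 2) → Fin 3 ⊕ Unit) (c : Fin 3 ⊕ Unit) (τ : Fin (M + 1) → Bool × Fin 3)

/-- **The cut-through cell `(★, ·, a′)` of a middle junction `k = i₀ + 1 ≤ M` over a CLOSED level, variant `F″`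
(`t_k ≠ u_{k+1}`), regime `z_k = t_k`, on the pin `z_k = w_k`, ON OR OFF the corner `w_{k+1} ~ t_k`** (row
`a = 2` needs no parity, so the corner hypothesis is not used): a package with target
`(A^{κ,2,a′} + A^{κ,2,1})(u_k,w_k,w_{k+1},t_k) · P^{S,0}(u_{k+1} − t_k, u_{k+1} − t_k)` — row `a = 2` of
`nonempty_jPkg_midE_cutR` with the exit line of level `k` replaced by the trivially witnessed `{t_k ↔ w_k}`
(`z = t = w`).  Twin of `NobleBoundsNLowE.nonempty_jPkg_lowE_cut` (which is the off-corner case).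
[cite: FitznerVanDerHofstad2017, §5.1 (5.4) second term (arXiv:1506.07977v2 p. 48); §6.1 (6.4), "Case a ≥ 2", "b = 1", "b ≥ 2" (pp. 58–59); App. B (pp. 73, 75); §4.4 (4.58), (4.62), (4.64) (pp. 41–42)] -/
theorem nonempty_jPkg_lowE_cutR (i i₀ : Fin (M + 1)) (hk : i₀.succ = i.castSucc) (κ : Fin d × Bool)
    (hb : (b i.castSucc).2 = (b i.castSucc).1 + stepVec κ) (hσ : (τ i).1 = true) {u₀ : Unit}
    (ha : a i.castSucc = Sum.inr u₀) {a' : Fin 3} (ha' : a i.succ = Sum.inl a')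
    (hty : t i.castSucc ≠ (b i.succ).1) (hzt : z i.castSucc = t i.castSucc) (hzw : z i.castSucc = w i.castSucc) :
    Nonempty (JPkg p (jctx M x b w t z a τ i.castSucc) (JFacts M x b w t z a c τ)
      ((blockAiota (Letters.perc d p) κ 2 a' (b i.castSucc).1 (w i.castSucc) (w i.succ) (t i.castSucc) +
          blockAiota (Letters.perc d p) κ 2 1 (b i.castSucc).1 (w i.castSucc) (w i.succ) (t i.castSucc)) *
        blockPS (Letters.perc d p) 0 ((b i.succ).1 - t i.castSucc) ((b i.succ).1 - t i.castSucc))) := by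
  -- exit class `a′ ≤ 1` above: the piece is empty (clause (8))
  by_cases h2 : a' = 2
  swap
  · exact nonempty_jPkg_of_sharp p c _ i hσ ha' h2 hty _
  subst h2
  -- degenerate parameters: the piece is empty
  by_cases hwt : w i.succ ≠ t i.castSucc
  swap
  · exact ⟨JPkg.vacuous p _ _
      (fun ω K₀ hF => hwt (hF.lowE_facts M x b w t z a c τ i i₀ hk hσ ha ha' hty).2.2.1) _⟩
  have htw : t i.castSucc = w i.castSucc := hzt.symm.trans hzw
  have h := nonempty_jPkg_lowECut_core p M x b w t z a c τ i i₀ hk κ hb hσ ha ha'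
    (event (ge 0) (b i.castSucc).2 (w i.succ)) (event (ge 1) (w i.succ) (t i.castSucc))
    (event (ge 0) (t i.castSucc) (b i.succ).1) (event (ge 0) (t i.castSucc) (b i.succ).1)
    (isFinitary_event _ _ _) (isFinitary_event _ _ _) (isFinitary_event _ _ _) (isFinitary_event _ _ _)
    (fun ω K₀ hF => ?_)
    (T₁ := blockAiota (Letters.perc d p) κ 2 2 (b i.castSucc).1 (w i.castSucc) (w i.succ) (t i.castSucc) +
      blockAiota (Letters.perc d p) κ 2 1 (b i.castSucc).1 (w i.castSucc) (w i.succ) (t i.castSucc))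
    (T₂ := blockPS (Letters.perc d p) 0 ((b i.succ).1 - t i.castSucc) ((b i.succ).1 - t i.castSucc)) ?_ ?_
  · exact h
  · obtain ⟨h0, h1, -, h3, h4⟩ := hF.conn_midE i hσ ha'
    rw [hzt] at h4
    refine ⟨?_, ?_, ?_, ?_⟩
    · rw [event_ge]; exact mem_openConnGe_zero_of_mem h0
    · rw [event_ge]; exact mem_openConnGe_one_of_ne h1 hwt
    · rw [event_ge]; exact mem_openConnGe_zero_of_mem h3
    · rw [event_ge]; exact mem_openConnGe_zero_of_mem h4
  · -- the `A`-letters: bond, `v → w′`, `w′ ←1→ t` (+ the trivially witnessed `t ↔ w`), split along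
    -- `{w′ ←1→ t} ⊆ {w′ ←2→ t} ∪ {w′ ←1̲→ t}`
    refine (junF_lowECut_xb_le₃ p M x b w t z a τ i hσ ha' _ _ _ _ _ _ _).trans ?_
    refine (measure_mono (genDisjOcc_triple_subset_quad _ _ _ (event (ge 0) (t i.castSucc) (w i.castSucc))
      (by rw [htw]; exact empty_mem_event_ge_zero_self (w i.castSucc)) 0 1 1 0)).trans ?_
    exact piPerc_cutR_two_le p hb hwt ![0, 1, 1, 0]
  · -- the `P^{S,0}`-letter: the two routes of the last sausage
    refine (junF_midECut_up_le₂ p M x b w t z a τ i hσ ha' _ _ _ _ _ _ _).trans ?_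
    rw [← blockPE_zero]
    exact piPerc_end_zero_le_blockPE p rfl _ rfl

/-- **The lower-`★` corner cut-through cell in the shape of the Sharp cell `(true, 0)`**: term 2 of (5.4) at lower
row `a = 2`, `δ_{z,t}·A'^{κ,2,a′}(u,w,w′,t)·P^{S,0}(u′−t,u′−t)` (`tgtReg … (true,0)`, the lower-`★` target
`tgtStarL` on the pin), PLUS the residue letter `X_R = δ_{z,t}·T2♯` at `a = 2` (`blockXR`) — the slot `hRS` of
`NobleBoundsNLowE.nonempty_jPkg_mid_starL'` re-targeted at the Sharp family (b2b-lace LEMMAS node N76-X2-D77,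
leaf T2c); the corner hypothesis `w_{k+1} ~ t_k` of that slot is not needed.
[cite: FitznerVanDerHofstad2017, §5.1 (5.4) second term (arXiv:1506.07977v2 p. 48); §6.1 (6.4) (pp. 58–59); App. B (pp. 73, 75); §4.4 (4.62), (4.64) (p. 42)] -/
theorem nonempty_jPkg_lowE_cutR_sharp (i i₀ : Fin (M + 1)) (hk : i₀.succ = i.castSucc) (κ : Fin d × Bool)
    (hb : (b i.castSucc).2 = (b i.castSucc).1 + stepVec κ) (hσ : (τ i).1 = true) {u₀ : Unit}
    (ha : a i.castSucc = Sum.inr u₀) {a' : Fin 3} (ha' : a i.succ = Sum.inl a') (h2 : a' = 2)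
    (hty : t i.castSucc ≠ (b i.succ).1) (hzt : z i.castSucc = t i.castSucc) (hzw : z i.castSucc = w i.castSucc) :
    Nonempty (JPkg p (jctx M x b w t z a τ i.castSucc) (JFacts M x b w t z a c τ)
      (tgtReg (Letters.perc d p) κ 2 a' (b i.castSucc).1 (w i.castSucc) (t i.castSucc) (z i.castSucc) (w i.succ)
          (b i.succ).1 (true, 0) +
        blockXR (Letters.perc d p) κ 2 a' (b i.castSucc).1 (w i.castSucc) (t i.castSucc) (z i.castSucc) (w i.succ)
          (b i.succ).1)) := by
  subst h2
  obtain ⟨P⟩ := nonempty_jPkg_lowE_cutR p M x b w t z a c τ i i₀ hk κ hb hσ ha ha' hty hzt hzw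
  refine ⟨P.monoTgt (le_of_eq ?_)⟩
  have e2 : blockAiota' (Letters.perc d p) κ 2 2 = blockAiota (Letters.perc d p) κ 2 2 :=
    blockAiota'_of_ne _ _ fun h => absurd h.1 (by decide)
  have e1 : blockAiota' (Letters.perc d p) κ 2 1 = blockAiota (Letters.perc d p) κ 2 1 :=
    blockAiota'_of_ne _ _ fun h => absurd h.1 (by decide)
  simp only [blockXR, tgtReg_true_zero, blockT2Sharp_two, hzt, kd_self, kdc_of_ne hty, one_mul, e2, e1, add_mul]

end Low

end Summit.CriticalPhenomena.LaceExpansionHighD.NobleBlocks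

end
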